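import Mathlib
import HarnessLib
import Summits.Ventures.LatticeQCDFlow.Exactness.SUNResidualTangentTimeDerivative
import Summits.Ventures.LatticeQCDFlow.Exactness.SUNJacobianTraceAlgebra

/-!
# The generator of the inverse `SU(N)` residual isotopy through the tangential operator, and its linearisation

HONEST FRAMING: exact (Metropolis-corrected) sampling algorithms for lattice gauge theory;
figures of merit are autocorrelation/cost numbers at stated couplings and volumes; no
continuum-physics claim.

Venture `LatticeQCDFlow` (cell pub-lqcd), topic `Exactness`; FANOUT row 10 (`eng-equiv`: `equiv/residual.py`,
`flows_jax/residual_flow.py` — residual / stout / stout-defect layers and their closed-form per-link log-det).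
NEW WORK of the cell; no definition (local notations only); nothing cited as a fact.  Series "the residual
layer's exact Jacobian IS the closed form" (8 files: `SUNJacobianTraceAlgebra`, `SUNResidualTangentDerivative`,
`SUNResidualTangentTimeDerivative`, `SUNResidualGeneratorDivergence`, `SUNResidualJacobiTrace`,
`SUNResidualJacobiIdentity`, `SUNResidualJacobiFlow`, `SUNResidualLayerJacobianDet`), continuing gen-11's
`SUNResidualLayerVelocity` … `SUNResidualLayerJacobian` (existence of a continuous positive exact Jacobian).

File 4 of the series (local notations as before, plus `σ(s) = (1 − cos πs)/2`, `σ′(s) = (π/2) sin πs`).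
* `hasFDerivAt_residualTangentBlockOp`, `hasFDerivAt_residualTangentOpMap(_right)` — the block and the tangential
  operator are differentiable OPERATOR-valued functions of `(τ, W)` (stated through `HasFDerivAt`, which elaborates
  for operator-valued maps under the Frobenius scope; `ContDiff` of such maps lives inside proofs);
* `fderiv_residualTangentOpMap_apply`, `hasDerivAt_residualTangentOp_apply_tau` — `(∂_h Top) X = 𝒫 ∂_h(Blk (𝒫X))`,
  `d/dτ Top X = 𝒫 (D Qamb_a·single a (𝒫X U_a) + [Qamb_a, Blk (𝒫X)])`;
* **`residualTangentOp_apply_generator`** — the generator `Z` of the inverse isotopy solves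
  `Top[σ(s), U, a] (Z_s(U)_a) = −σ′(s) Qamb_a(U)`; **`residualTangentOp_apply_fderiv_generator`** — its linearisation
  `Top (∂_{single a (X U_a)} Z_a) = −σ′(s) ∂_{single a (X U_a)} Qamb_a − ∂_{single a (X U_a)} (Top · Z_a)`.

Printed counterparts, NAMED ONLY: Lüscher, CMP 293 (2010) 899, §3 eqs. (3.4)–(3.9); Abbott et al.,
arXiv:2305.02402 §4.2; Morningstar–Peardon, PRD 69 (2004) 054501; Abel–Jacobi–Liouville (tree:
`Literature.Analysis.ODE.LiouvilleFormula`).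
-/

noncomputable section

namespace Summit.Ventures.LatticeQCDFlow.Exactness

open Literature.MathematicalPhysics.QuantumFieldTheory
open Literature.MathematicalPhysics.QuantumFieldTheory.Luscher2010
open Literature.MathematicalPhysics.QuantumFieldTheory.WilsonFlow
open Summit.Ventures.LatticeQCDFlow.TrivializingMaps
open Filter Set
open scoped Matrix Matrix.Norms.Frobenius Topology ContDiff

variable {d L n : ℕ} [NeZero L]

section Divergence

variable (p : Edge d L → Prop) [DecidablePred p]
  (Q : {e : Edge d L // p e} → ({f : Edge d L // ¬p f} → Matrix.specialUnitaryGroup (Fin n) ℂ) →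
    Matrix (Fin n) (Fin n) ℂ → Matrix (Fin n) (Fin n) ℂ)
  (κ : {e : Edge d L // p e} → ({f : Edge d L // ¬p f} → Matrix.specialUnitaryGroup (Fin n) ℂ) → ℝ)
  (Qamb : {e : Edge d L // p e} → AmbConfig d L n → Matrix (Fin n) (Fin n) ℂ)

set_option quotPrecheck false in
/-- The residual isotopy at time `τ` (local notation, as in `SUNResidualIsotopy`). -/
local notation "famb[" τ "]" => (fun (W : AmbConfig d L n) (e : Edge d L) =>
  if h : p e then NormedSpace.exp ((τ : ℝ) • Qamb ⟨e, h⟩ W) * W e else W e)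

set_option quotPrecheck false in
/-- The block of the tangential operator (local notation, as in `SUNResidualTangentOperator`). -/
local notation "Blk[" τ ", " W ", " a "]" =>
  ((fderiv ℝ (fun Y : Matrix (Fin n) (Fin n) ℂ => Y * ((famb[τ]) W a)ᴴ) 0).comp
    ((fderiv ℝ (fun W' : AmbConfig d L n => W' a) 0).comp
      ((fderiv ℝ (famb[τ]) W).comp
        ((fderiv ℝ (fun Y : Matrix (Fin n) (Fin n) ℂ => (Pi.single a Y : AmbConfig d L n)) 0).comp
          (fderiv ℝ (fun Y : Matrix (Fin n) (Fin n) ℂ => Y * W a) 0)))))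

set_option quotPrecheck false in
/-- The tangential operator (local notation, as in `SUNResidualTangentOperator`). -/
local notation "Top[" τ ", " W ", " a "]" =>
  ((fderiv ℝ (suProj (n := n)) 0).comp ((Blk[τ, W, a]).comp (fderiv ℝ (suProj (n := n)) 0)) +
    (ContinuousLinearMap.id ℝ (Matrix (Fin n) (Fin n) ℂ) - fderiv ℝ (suProj (n := n)) 0))

set_option quotPrecheck false in
/-- The time reparametrisation `σ(s) = (1 − cos πs)/2` (local notation). -/
local notation "σ(" s ")" => ((1 - Real.cos (Real.pi * s)) / 2)

set_option quotPrecheck false in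
/-- Its derivative `σ′(s) = (π/2) sin πs` (local notation). -/
local notation "σ'(" s ")" => (Real.pi / 2 * Real.sin (Real.pi * s))

/-! ## The operator-valued maps are differentiable (statements through `HasFDerivAt`) -/

/-- **The block is a differentiable operator-valued function of `(τ, W)`** (its derivative is its
`fderiv`; the operator-space norms are supplied inside the proof). -/
theorem hasFDerivAt_residualTangentBlockOp (hQ2 : ∀ a, ContDiff ℝ 2 (Qamb a)) (a : Edge d L)
    (q : ℝ × AmbConfig d L n) :
    HasFDerivAt (fun q : ℝ × AmbConfig d L n => Blk[q.1, q.2, a])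
      (fderiv ℝ (fun q : ℝ × AmbConfig d L n => Blk[q.1, q.2, a]) q) q := by
  letI i1 : NormedAddCommGroup (Matrix (Fin n) (Fin n) ℂ →L[ℝ] Matrix (Fin n) (Fin n) ℂ) :=
    ContinuousLinearMap.toNormedAddCommGroup
  letI i2 : NormedSpace ℝ (Matrix (Fin n) (Fin n) ℂ →L[ℝ] Matrix (Fin n) (Fin n) ℂ) :=
    ContinuousLinearMap.toNormedSpace
  letI i3 : NormedAddCommGroup (AmbConfig d L n →L[ℝ] AmbConfig d L n) :=
    ContinuousLinearMap.toNormedAddCommGroup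
  letI i4 : NormedSpace ℝ (AmbConfig d L n →L[ℝ] AmbConfig d L n) := ContinuousLinearMap.toNormedSpace
  letI i5 : NormedAddCommGroup (AmbConfig d L n →L[ℝ] Matrix (Fin n) (Fin n) ℂ) :=
    ContinuousLinearMap.toNormedAddCommGroup
  letI i6 : NormedSpace ℝ (AmbConfig d L n →L[ℝ] Matrix (Fin n) (Fin n) ℂ) :=
    ContinuousLinearMap.toNormedSpace
  letI i7 : NormedAddCommGroup (Matrix (Fin n) (Fin n) ℂ →L[ℝ] AmbConfig d L n) :=
    ContinuousLinearMap.toNormedAddCommGroup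
  letI i8 : NormedSpace ℝ (Matrix (Fin n) (Fin n) ℂ →L[ℝ] AmbConfig d L n) :=
    ContinuousLinearMap.toNormedSpace
  have hF2 : ContDiff ℝ 2 (fun q : ℝ × AmbConfig d L n => (famb[q.1]) q.2) :=
    contDiff_residualIsotopy p Qamb hQ2
  have hD : ContDiff ℝ 1 (fun q : ℝ × AmbConfig d L n => fderiv ℝ (famb[q.1]) q.2) := by
    have hunc : ContDiff ℝ 2 (Function.uncurry fun (q : ℝ × AmbConfig d L n) (W : AmbConfig d L n) =>
        (famb[q.1]) W) := by
      have h1 : (Function.uncurry fun (q : ℝ × AmbConfig d L n) (W : AmbConfig d L n) => (famb[q.1]) W) =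
          (fun r : ℝ × AmbConfig d L n => (famb[r.1]) r.2) ∘
            (fun z : (ℝ × AmbConfig d L n) × AmbConfig d L n => (z.1.1, z.2)) := by
        funext z
        rfl
      rw [h1]
      exact hF2.comp ((contDiff_fst.comp contDiff_fst).prodMk contDiff_snd)
    exact hunc.fderiv contDiff_snd (by norm_num)
  have hm : ContDiff ℝ 2 (fun q : ℝ × AmbConfig d L n => ((famb[q.1]) q.2 a)ᴴ) :=
    contDiff_conjTranspose.comp ((contDiff_eval a).comp hF2)
  have hR : ContDiff ℝ 1 (fun q : ℝ × AmbConfig d L n =>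
      fderiv ℝ (fun Y : Matrix (Fin n) (Fin n) ℂ => Y * ((famb[q.1]) q.2 a)ᴴ) 0) := by
    have hunc : ContDiff ℝ 2 (Function.uncurry fun (q : ℝ × AmbConfig d L n)
        (Y : Matrix (Fin n) (Fin n) ℂ) => Y * ((famb[q.1]) q.2 a)ᴴ) :=
      contDiff_snd.mul (hm.comp contDiff_fst)
    exact hunc.fderiv contDiff_const (by norm_num)
  have hRW : ContDiff ℝ 1 (fun q : ℝ × AmbConfig d L n =>
      fderiv ℝ (fun Y : Matrix (Fin n) (Fin n) ℂ => Y * q.2 a) 0) := by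
    have hunc : ContDiff ℝ 2 (Function.uncurry fun (q : ℝ × AmbConfig d L n)
        (Y : Matrix (Fin n) (Fin n) ℂ) => Y * q.2 a) :=
      contDiff_snd.mul (((contDiff_eval a).comp contDiff_snd).comp contDiff_fst)
    exact hunc.fderiv contDiff_const (by norm_num)
  have hBlk : ContDiff ℝ 1 (fun q : ℝ × AmbConfig d L n => Blk[q.1, q.2, a]) :=
    hR.clm_comp (contDiff_const.clm_comp (hD.clm_comp (contDiff_const.clm_comp hRW)))
  exact ((hBlk.differentiable (by norm_num)).differentiableAt).hasFDerivAt

/-- **The tangential operator is a differentiable operator-valued function of `(τ, W)`.** -/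
theorem hasFDerivAt_residualTangentOpMap (hQ2 : ∀ a, ContDiff ℝ 2 (Qamb a)) (a : Edge d L)
    (q : ℝ × AmbConfig d L n) :
    HasFDerivAt (fun q : ℝ × AmbConfig d L n => Top[q.1, q.2, a])
      (fderiv ℝ (fun q : ℝ × AmbConfig d L n => Top[q.1, q.2, a]) q) q := by
  letI i1 : NormedAddCommGroup (Matrix (Fin n) (Fin n) ℂ →L[ℝ] Matrix (Fin n) (Fin n) ℂ) :=
    ContinuousLinearMap.toNormedAddCommGroup
  letI i2 : NormedSpace ℝ (Matrix (Fin n) (Fin n) ℂ →L[ℝ] Matrix (Fin n) (Fin n) ℂ) :=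
    ContinuousLinearMap.toNormedSpace
  have hBlk : ∀ q : ℝ × AmbConfig d L n, HasFDerivAt (fun q : ℝ × AmbConfig d L n => Blk[q.1, q.2, a])
      (fderiv ℝ (fun q : ℝ × AmbConfig d L n => Blk[q.1, q.2, a]) q) q :=
    hasFDerivAt_residualTangentBlockOp p Qamb hQ2 a
  have hTop : HasFDerivAt (fun q : ℝ × AmbConfig d L n => Top[q.1, q.2, a])
      (((ContinuousLinearMap.compL ℝ (Matrix (Fin n) (Fin n) ℂ) (Matrix (Fin n) (Fin n) ℂ)
          (Matrix (Fin n) (Fin n) ℂ)) (fderiv ℝ (suProj (n := n)) 0)).comp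
        (((ContinuousLinearMap.compL ℝ (Matrix (Fin n) (Fin n) ℂ) (Matrix (Fin n) (Fin n) ℂ)
          (Matrix (Fin n) (Fin n) ℂ)).flip (fderiv ℝ (suProj (n := n)) 0)).comp
          (fderiv ℝ (fun q : ℝ × AmbConfig d L n => Blk[q.1, q.2, a]) q)) + 0) q := by
    refine HasFDerivAt.add ?_ (hasFDerivAt_const _ q)
    exact (((ContinuousLinearMap.compL ℝ (Matrix (Fin n) (Fin n) ℂ) (Matrix (Fin n) (Fin n) ℂ)
      (Matrix (Fin n) (Fin n) ℂ)) (fderiv ℝ (suProj (n := n)) 0)).hasFDerivAt.comp q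
      ((((ContinuousLinearMap.compL ℝ (Matrix (Fin n) (Fin n) ℂ) (Matrix (Fin n) (Fin n) ℂ)
        (Matrix (Fin n) (Fin n) ℂ)).flip (fderiv ℝ (suProj (n := n)) 0)).hasFDerivAt.comp q (hBlk q))))
  exact hTop.differentiableAt.hasFDerivAt

/-- Fixed-time slice: `W ↦ Top[τ, W, a]` is differentiable, with derivative its `fderiv`. -/
theorem hasFDerivAt_residualTangentOpMap_right (hQ2 : ∀ a, ContDiff ℝ 2 (Qamb a)) (τ : ℝ) (a : Edge d L)
    (W₀ : AmbConfig d L n) :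
    HasFDerivAt (fun W : AmbConfig d L n => Top[τ, W, a])
      (fderiv ℝ (fun W : AmbConfig d L n => Top[τ, W, a]) W₀) W₀ := by
  letI i1 : NormedAddCommGroup (Matrix (Fin n) (Fin n) ℂ →L[ℝ] Matrix (Fin n) (Fin n) ℂ) :=
    ContinuousLinearMap.toNormedAddCommGroup
  letI i2 : NormedSpace ℝ (Matrix (Fin n) (Fin n) ℂ →L[ℝ] Matrix (Fin n) (Fin n) ℂ) :=
    ContinuousLinearMap.toNormedSpace
  have h := (hasFDerivAt_residualTangentOpMap p Qamb hQ2 a (τ, W₀)).comp W₀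
    (hasFDerivAt_prodMk_right (𝕜 := ℝ) (E := ℝ) (F := AmbConfig d L n) τ W₀)
  exact h.differentiableAt.hasFDerivAt

/-- **Derivative of `Top` applied to a vector, through the block**: for every direction `h`,
`(∂_h Top[τ, ·, a]) X = 𝒫 (∂_h (Blk[τ, ·, a] (𝒫 X)))`. -/
theorem fderiv_residualTangentOpMap_apply (hQ2 : ∀ a, ContDiff ℝ 2 (Qamb a)) (τ : ℝ) (a : Edge d L)
    (W₀ h : AmbConfig d L n) (X : Matrix (Fin n) (Fin n) ℂ) :
    fderiv ℝ (fun W : AmbConfig d L n => Top[τ, W, a]) W₀ h X =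
      suProj (fderiv ℝ (fun W : AmbConfig d L n => (Blk[τ, W, a]) (suProj X)) W₀ h) := by
  letI i1 : NormedAddCommGroup (Matrix (Fin n) (Fin n) ℂ →L[ℝ] Matrix (Fin n) (Fin n) ℂ) :=
    ContinuousLinearMap.toNormedAddCommGroup
  letI i2 : NormedSpace ℝ (Matrix (Fin n) (Fin n) ℂ →L[ℝ] Matrix (Fin n) (Fin n) ℂ) :=
    ContinuousLinearMap.toNormedSpace
  have hT := hasFDerivAt_residualTangentOpMap_right p Qamb hQ2 τ a W₀
  -- apply to the vector `X`
  have h1 : HasFDerivAt (fun W : AmbConfig d L n => (Top[τ, W, a]) X)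
      ((ContinuousLinearMap.apply ℝ (Matrix (Fin n) (Fin n) ℂ) X).comp
        (fderiv ℝ (fun W : AmbConfig d L n => Top[τ, W, a]) W₀)) W₀ :=
    (ContinuousLinearMap.apply ℝ (Matrix (Fin n) (Fin n) ℂ) X).hasFDerivAt.comp W₀ hT
  -- the same function through the block
  have hg : DifferentiableAt ℝ (fun W : AmbConfig d L n => (Blk[τ, W, a]) (suProj X)) W₀ :=
    ((contDiff_residualTangentBlock_apply_right p Qamb hQ2 τ a (suProj X)).differentiable
      (by norm_num)).differentiableAt
  have hP : HasFDerivAt (suProj (n := n)) (fderiv ℝ (suProj (n := n)) 0)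
      ((Blk[τ, W₀, a]) (suProj X)) := by
    have hd : DifferentiableAt ℝ (suProj (n := n)) ((Blk[τ, W₀, a]) (suProj X)) :=
      ((contDiff_suProj (m := 1)).differentiable (by norm_num)).differentiableAt
    have heq : fderiv ℝ (suProj (n := n)) ((Blk[τ, W₀, a]) (suProj X)) = fderiv ℝ (suProj (n := n)) 0 := by
      ext Y
      rw [fderiv_suProj_apply, fderiv_suProj_apply]
    rw [← heq]
    exact hd.hasFDerivAt
  have h2 : HasFDerivAt (fun W : AmbConfig d L n => (Top[τ, W, a]) X)
      ((fderiv ℝ (suProj (n := n)) 0).comp (fderiv ℝ (fun W : AmbConfig d L n => (Blk[τ, W, a]) (suProj X)) W₀)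
        + 0) W₀ := by
    have hfun : (fun W : AmbConfig d L n => (Top[τ, W, a]) X) =
        fun W => suProj ((Blk[τ, W, a]) (suProj X)) + (X - suProj X) := by
      funext W
      rw [residualTangentOp_apply, residualTangentBlock_apply]
    rw [hfun]
    exact (hP.comp W₀ hg.hasFDerivAt).add (hasFDerivAt_const _ W₀)
  have h3 := h1.unique h2
  rw [add_zero] at h3
  have h4 := congrArg (fun T : AmbConfig d L n →L[ℝ] Matrix (Fin n) (Fin n) ℂ => T h) h3
  simp only [ContinuousLinearMap.comp_apply] at h4
  exact h4.trans (fderiv_suProj_apply 0 _)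

/-- **Time derivative of `Top` applied to a vector**: at an `SU(n)^E` configuration and an active
link, `d/dτ Top[τ, U, a] X = 𝒫 (D Qamb_a(U)·single a (𝒫X U_a) + [Qamb_a(U), Blk (𝒫 X)])`. -/
theorem hasDerivAt_residualTangentOp_apply_tau (hQ2 : ∀ a, ContDiff ℝ 2 (Qamb a))
    (hQ : ∀ a y, ∀ U ∈ Matrix.specialUnitaryGroup (Fin n) ℂ, (Q a y U)ᴴ = -Q a y U ∧ (Q a y U).trace = 0)
    (hQambQ : ∀ a (U : GaugeConfig d L (Matrix.specialUnitaryGroup (Fin n) ℂ)),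
      Qamb a (coeConfig U) = Q a (fun f => U f) (U a.1 : Matrix (Fin n) (Fin n) ℂ))
    (U : GaugeConfig d L (Matrix.specialUnitaryGroup (Fin n) ℂ)) {a : Edge d L} (ha : p a)
    (X : Matrix (Fin n) (Fin n) ℂ) (τ : ℝ) :
    HasDerivAt (fun τ' : ℝ => (Top[τ', coeConfig U, a]) X)
      (suProj (fderiv ℝ (Qamb ⟨a, ha⟩) (coeConfig U) (Pi.single a (suProj X * (U a : Matrix (Fin n) (Fin n) ℂ)))
        + (Qamb ⟨a, ha⟩ (coeConfig U) * (Blk[τ, coeConfig U, a]) (suProj X)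
          - (Blk[τ, coeConfig U, a]) (suProj X) * Qamb ⟨a, ha⟩ (coeConfig U)))) τ := by
  have hB := hasDerivAt_residualTangentBlock_tau p Q Qamb hQ2 hQ hQambQ U ha (suProj X) τ
  have hP : HasFDerivAt (suProj (n := n)) (fderiv ℝ (suProj (n := n)) 0)
      ((Blk[τ, coeConfig U, a]) (suProj X)) := by
    have hd : DifferentiableAt ℝ (suProj (n := n)) ((Blk[τ, coeConfig U, a]) (suProj X)) :=
      ((contDiff_suProj (m := 1)).differentiable (by norm_num)).differentiableAt
    have heq : fderiv ℝ (suProj (n := n)) ((Blk[τ, coeConfig U, a]) (suProj X)) = fderiv ℝ (suProj (n := n)) 0 := by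
      ext Y
      rw [fderiv_suProj_apply, fderiv_suProj_apply]
    rw [← heq]
    exact hd.hasFDerivAt
  have hfun : (fun τ' : ℝ => (Top[τ', coeConfig U, a]) X) =
      fun τ' => suProj ((Blk[τ', coeConfig U, a]) (suProj X)) + (X - suProj X) := by
    funext τ'
    rw [residualTangentOp_apply, residualTangentBlock_apply]
  rw [hfun]
  have h := (hP.comp_hasDerivAt τ hB).add_const (X - suProj X)
  exact h.congr_deriv (fderiv_suProj_apply 0 _)

/-! ## The generator through the tangential operator -/

/-- **The generator solves the tangential linear system**: for the generator `Z` of the inverse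
residual isotopy (`exists_residualIsotopy_generator`: tangent, zero on frozen links, cancellation
identity), at every `SU(n)^E` configuration and active link `a`:
`Top[σ(s), U, a] (Z_s(U)_a) = −σ′(s) · Qamb_a(U)`. -/
theorem residualTangentOp_apply_generator (hQ2 : ∀ a, ContDiff ℝ 2 (Qamb a))
    (hQ : ∀ a y, ∀ U ∈ Matrix.specialUnitaryGroup (Fin n) ℂ, (Q a y U)ᴴ = -Q a y U ∧ (Q a y U).trace = 0)
    (hlip : ∀ a y, ∀ U ∈ Matrix.specialUnitaryGroup (Fin n) ℂ, ∀ V ∈ Matrix.specialUnitaryGroup (Fin n) ℂ,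
      frobNorm (Q a y U - Q a y V) ≤ κ a y * frobNorm (U - V))
    (hQambQ : ∀ a (U : GaugeConfig d L (Matrix.specialUnitaryGroup (Fin n) ℂ)),
      Qamb a (coeConfig U) = Q a (fun f => U f) (U a.1 : Matrix (Fin n) (Fin n) ℂ))
    {Z : ℝ → AmbConfig d L n → AmbConfig d L n}
    (hZsu : ∀ (s : ℝ) (U : GaugeConfig d L (Matrix.specialUnitaryGroup (Fin n) ℂ)) (e : Edge d L),
      (Z s (coeConfig U) e)ᴴ = -Z s (coeConfig U) e ∧ (Z s (coeConfig U) e).trace = 0)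
    (hZid : ∀ (s : ℝ) (U : GaugeConfig d L (Matrix.specialUnitaryGroup (Fin n) ℂ)) (a : Edge d L) (ha : p a),
      fderiv ℝ (famb[σ(s)]) (coeConfig U) (Pi.single a (Z s (coeConfig U) a * (U a : Matrix (Fin n) (Fin n) ℂ))) a =
        -(σ'(s) • (Qamb ⟨a, ha⟩ (coeConfig U) *
          (NormedSpace.exp (σ(s) • Qamb ⟨a, ha⟩ (coeConfig U)) * (U a : Matrix (Fin n) (Fin n) ℂ)))))
    (s : ℝ) (U : GaugeConfig d L (Matrix.specialUnitaryGroup (Fin n) ℂ)) {a : Edge d L} (ha : p a) :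
    (Top[σ(s), coeConfig U, a]) (Z s (coeConfig U) a) = -(σ'(s) • Qamb ⟨a, ha⟩ (coeConfig U)) := by
  obtain ⟨hz1, hz2⟩ := hZsu s U a
  rw [residualTangentOp_apply_of_skew p Q κ Qamb hQ2 hQ hlip hQambQ (σ(s)) U ha hz1 hz2,
    residualTangentBlock_apply, coeConfig_apply, hZid s U a ha]
  simp only [ha, ↓reduceDIte, coeConfig_apply]
  have hfmem : NormedSpace.exp (σ(s) • Qamb ⟨a, ha⟩ (coeConfig U)) * (U a : Matrix (Fin n) (Fin n) ℂ) ∈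
      Matrix.specialUnitaryGroup (Fin n) ℂ := by
    have hm := residualIsotopy_mem p Q Qamb hQ hQambQ (σ(s)) U a
    simpa only [ha, ↓reduceDIte, coeConfig_apply] using hm
  have hffH : (NormedSpace.exp (σ(s) • Qamb ⟨a, ha⟩ (coeConfig U)) * (U a : Matrix (Fin n) (Fin n) ℂ)) *
      (NormedSpace.exp (σ(s) • Qamb ⟨a, ha⟩ (coeConfig U)) * (U a : Matrix (Fin n) (Fin n) ℂ))ᴴ = 1 := by
    have h := Matrix.mem_unitaryGroup_iff.mp (Matrix.mem_specialUnitaryGroup_iff.mp hfmem).1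
    simpa only [Matrix.star_eq_conjTranspose] using h
  rw [neg_mul, smul_mul_assoc, Matrix.mul_assoc, hffH, Matrix.mul_one]

/-- **Link derivative of the generator through the tangential operator** (differentiate the previous
identity along `r ↦ U[a ↦ e^{rX} U_a]`, `X ∈ 𝔰𝔲(n)`):
`Top (∂_{single a (X U_a)} Z_a) = −σ′(s) · ∂_{single a (X U_a)} Qamb_a − ∂_{single a (X U_a)} (Top · ζ)|_{ζ = Z_a}`
(the last term: the derivative of `W ↦ Top[σ(s), W, a] ζ` for the FIXED vector `ζ = Z_s(U)_a`). -/
theorem residualTangentOp_apply_fderiv_generator (hQ2 : ∀ a, ContDiff ℝ 2 (Qamb a))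
    (hQ : ∀ a y, ∀ U ∈ Matrix.specialUnitaryGroup (Fin n) ℂ, (Q a y U)ᴴ = -Q a y U ∧ (Q a y U).trace = 0)
    (hlip : ∀ a y, ∀ U ∈ Matrix.specialUnitaryGroup (Fin n) ℂ, ∀ V ∈ Matrix.specialUnitaryGroup (Fin n) ℂ,
      frobNorm (Q a y U - Q a y V) ≤ κ a y * frobNorm (U - V))
    (hQambQ : ∀ a (U : GaugeConfig d L (Matrix.specialUnitaryGroup (Fin n) ℂ)),
      Qamb a (coeConfig U) = Q a (fun f => U f) (U a.1 : Matrix (Fin n) (Fin n) ℂ))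
    {Z : ℝ → AmbConfig d L n → AmbConfig d L n}
    (hZ1 : ContDiff ℝ 1 (fun q : ℝ × AmbConfig d L n => Z q.1 q.2))
    (hZsu : ∀ (s : ℝ) (U : GaugeConfig d L (Matrix.specialUnitaryGroup (Fin n) ℂ)) (e : Edge d L),
      (Z s (coeConfig U) e)ᴴ = -Z s (coeConfig U) e ∧ (Z s (coeConfig U) e).trace = 0)
    (hZid : ∀ (s : ℝ) (U : GaugeConfig d L (Matrix.specialUnitaryGroup (Fin n) ℂ)) (a : Edge d L) (ha : p a),
      fderiv ℝ (famb[σ(s)]) (coeConfig U) (Pi.single a (Z s (coeConfig U) a * (U a : Matrix (Fin n) (Fin n) ℂ))) a =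
        -(σ'(s) • (Qamb ⟨a, ha⟩ (coeConfig U) *
          (NormedSpace.exp (σ(s) • Qamb ⟨a, ha⟩ (coeConfig U)) * (U a : Matrix (Fin n) (Fin n) ℂ)))))
    (s : ℝ) (U : GaugeConfig d L (Matrix.specialUnitaryGroup (Fin n) ℂ)) {a : Edge d L} (ha : p a)
    {X : Matrix (Fin n) (Fin n) ℂ} (hX : Xᴴ = -X) (hX0 : X.trace = 0) :
    (Top[σ(s), coeConfig U, a]) (fderiv ℝ (fun W : AmbConfig d L n => Z s W a) (coeConfig U)
        (Pi.single a (X * (U a : Matrix (Fin n) (Fin n) ℂ)))) =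
      -(σ'(s) • fderiv ℝ (Qamb ⟨a, ha⟩) (coeConfig U) (Pi.single a (X * (U a : Matrix (Fin n) (Fin n) ℂ))))
        - fderiv ℝ (fun W : AmbConfig d L n => (Top[σ(s), W, a]) (Z s (coeConfig U) a)) (coeConfig U)
            (Pi.single a (X * (U a : Matrix (Fin n) (Fin n) ℂ))) := by
  letI i1 : NormedAddCommGroup (Matrix (Fin n) (Fin n) ℂ →L[ℝ] Matrix (Fin n) (Fin n) ℂ) :=
    ContinuousLinearMap.toNormedAddCommGroup
  letI i2 : NormedSpace ℝ (Matrix (Fin n) (Fin n) ℂ →L[ℝ] Matrix (Fin n) (Fin n) ℂ) :=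
    ContinuousLinearMap.toNormedSpace
  -- the curve through `U` along `X` at the link `a`
  have hγmem : ∀ r : ℝ, NormedSpace.exp (r • X) * (U a : Matrix (Fin n) (Fin n) ℂ) ∈
      Matrix.specialUnitaryGroup (Fin n) ℂ := exp_smul_mul_mem_specialUnitaryGroup (U a).2 hX hX0
  obtain ⟨γ, hγ⟩ : ∃ γ : ℝ → AmbConfig d L n, γ = fun r =>
      Function.update (coeConfig U) a (NormedSpace.exp (r • X) * (U a : Matrix (Fin n) (Fin n) ℂ)) := ⟨_, rfl⟩
  have hγ0 : γ 0 = coeConfig U := by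
    rw [hγ]
    simp only [zero_smul, NormedSpace.exp_zero, one_mul]
    exact Function.update_eq_self a (coeConfig U)
  have hγd : HasDerivAt γ (Pi.single a (X * (U a : Matrix (Fin n) (Fin n) ℂ))) 0 := by
    have h := hasDerivAt_update_exp_smul (coeConfig U) a X
    rw [coeConfig_apply] at h
    rw [hγ]
    exact h
  have hγU : ∀ r : ℝ, γ r = coeConfig (Function.update U a ⟨_, hγmem r⟩) := fun r => by
    rw [hγ]
    exact update_coeConfig_eq U a ⟨_, hγmem r⟩
  -- the identity along the curve
  have hident : ∀ r : ℝ, (Top[σ(s), γ r, a]) (Z s (γ r) a) = -(σ'(s) • Qamb ⟨a, ha⟩ (γ r)) := by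
    intro r
    rw [hγU]
    exact residualTangentOp_apply_generator p Q κ Qamb hQ2 hQ hlip hQambQ hZsu hZid s _ ha
  -- derivative of the left-hand side: Leibniz rule for `operator(r) (vector(r))`
  have hc : HasDerivAt (fun r : ℝ => Top[σ(s), γ r, a])
      (fderiv ℝ (fun W : AmbConfig d L n => Top[σ(s), W, a]) (coeConfig U)
        (Pi.single a (X * (U a : Matrix (Fin n) (Fin n) ℂ)))) 0 :=
    (hasFDerivAt_residualTangentOpMap_right p Qamb hQ2 (σ(s)) a (coeConfig U)).comp_hasDerivAt_of_eq
      (0 : ℝ) hγd hγ0.symm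
  have hZd : DifferentiableAt ℝ (fun W : AmbConfig d L n => Z s W a) (coeConfig U) := by
    have h1 : ContDiff ℝ 1 (fun W : AmbConfig d L n => Z s W a) :=
      (contDiff_eval a).comp (hZ1.comp ((contDiff_const (c := s)).prodMk contDiff_id))
    exact (h1.differentiable (by norm_num)).differentiableAt
  have hv : HasDerivAt (fun r : ℝ => Z s (γ r) a)
      (fderiv ℝ (fun W : AmbConfig d L n => Z s W a) (coeConfig U)
        (Pi.single a (X * (U a : Matrix (Fin n) (Fin n) ℂ)))) 0 :=
    hZd.hasFDerivAt.comp_hasDerivAt_of_eq (0 : ℝ) hγd hγ0.symm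
  have hL := hc.clm_apply hv
  rw [hγ0] at hL
  -- derivative of the right-hand side
  have hQd : DifferentiableAt ℝ (Qamb ⟨a, ha⟩) (coeConfig U) :=
    (((hQ2 ⟨a, ha⟩).differentiable (by norm_num)).differentiableAt)
  have hR : HasDerivAt (fun r : ℝ => -(σ'(s) • Qamb ⟨a, ha⟩ (γ r)))
      (-(σ'(s) • fderiv ℝ (Qamb ⟨a, ha⟩) (coeConfig U) (Pi.single a (X * (U a : Matrix (Fin n) (Fin n) ℂ))))) 0 :=
    ((hQd.hasFDerivAt.comp_hasDerivAt_of_eq (0 : ℝ) hγd hγ0.symm).const_smul (σ'(s))).neg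
  -- compare
  have hR' := hR.congr_of_eventuallyEq (Filter.Eventually.of_forall fun r => hident r)
  have heq := hL.unique hR'
  -- the operator derivative applied to the fixed vector `ζ = Z_s(U)_a` is a vector-valued derivative
  have happ : fderiv ℝ (fun W : AmbConfig d L n => (Top[σ(s), W, a]) (Z s (coeConfig U) a)) (coeConfig U)
      (Pi.single a (X * (U a : Matrix (Fin n) (Fin n) ℂ))) =
      fderiv ℝ (fun W : AmbConfig d L n => Top[σ(s), W, a]) (coeConfig U)
        (Pi.single a (X * (U a : Matrix (Fin n) (Fin n) ℂ))) (Z s (coeConfig U) a) := by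
    have h1 : HasFDerivAt (fun W : AmbConfig d L n => (Top[σ(s), W, a]) (Z s (coeConfig U) a))
        ((ContinuousLinearMap.apply ℝ (Matrix (Fin n) (Fin n) ℂ) (Z s (coeConfig U) a)).comp
          (fderiv ℝ (fun W : AmbConfig d L n => Top[σ(s), W, a]) (coeConfig U))) (coeConfig U) :=
      (ContinuousLinearMap.apply ℝ (Matrix (Fin n) (Fin n) ℂ) (Z s (coeConfig U) a)).hasFDerivAt.comp (coeConfig U)
        (hasFDerivAt_residualTangentOpMap_right p Qamb hQ2 (σ(s)) a (coeConfig U))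
    have h2 := congrArg (fun T : AmbConfig d L n →L[ℝ] Matrix (Fin n) (Fin n) ℂ =>
      T (Pi.single a (X * (U a : Matrix (Fin n) (Fin n) ℂ)))) h1.fderiv
    exact h2
  -- `c'(Z_a) + Top (∂Z_a) = -σ' ∂Q`
  have key := eq_sub_of_add_eq' heq
  refine key.trans ?_
  congr 1
  exact happ.symm

end Divergence

end Summit.Ventures.LatticeQCDFlow.Exactness

end
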